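import Literature.NumberTheory.EllipticCurves.ZpExtensionEisensteinOrdinaryInvariantsBoundProofs
import Literature.NumberTheory.EllipticCurves.ZpExtensionEisensteinSelmerStructureProofs
import Literature.NumberTheory.EllipticCurves.ZpExtensionEisensteinH3OrdinaryProofs
import HarnessLib

/-!
# `[T]^{2p^s}` kills the local invariants of the `π`-adic ordinary quotients `(T/π^iT)/Fil_w` of Howard's Eisenstein
# levels (theorems only — no definition, no named fact, no instance, no `sorry`)

Topic `NumberTheory/EllipticCurves` (cell `pub/bsd-print-x9`, shared μ-crux `MuInequalityCoherentPairOfPrint`, registered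
stub `stub_h5bAtS`; brick (F4a) = the H⁰-half of (F4) of the uniform-`ι` road (design of seat `bsd-line-x9-p1-w3` g6,
2026-08-28T21:10:46Z: «INV = (B4) with `N := piPow + twistedFil` ⇒ `[T]^{2p^s}` kills `H⁰(K_w, gr_i) ∀ i`»)).  Sequel of
`ZpExtensionEisensteinOrdinaryInvariantsBoundProofs` ((B4): Cayley–Hamilton modulo a stable subgroup).

B. Howard, Compositio Math. 140 (2004), §3.1 and Def. 3.2.5 (arXiv:1202.6340 p. 15–16): at a place `w ∣ p` the ordinary
local condition on `T_𝔮 = T_pE ⊗ Λ/(T^m + p)(ψ)` is read through the filtration `Fil_w T_𝔮 ⊂ T_𝔮` and ALL the quotients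
`T_𝔮/π^i` (Def. 1.1.3, `Quot(T)`).  The `π`-adic level `T/π^iT` is presented by the `p`-adic level
`W_{m,j} = E[p^j] ⊗ A_{m,j}(ψ)` (`j` the host of `i`) modulo `[T]^i · W_{m,j}`, and its ordinary quotient `gr_w(T/π^iT)` by
`W_{m,j}` modulo `[T]^i · W_{m,j} + Fil_w W_{m,j}`.  Hence an element of `H⁰(K_w, gr_w(T/π^iT))` is an `x ∈ W_{m,j}` with
`g x − x ∈ [T]^i · W_{m,j} + Fil_w W_{m,j}` for all `g ∈ Γ_{K_w}`, and (B4) applied to THIS stable subgroup gives: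

* `ZpExtension.mk_X_pow_two_mul_smul_mem_sup_of_apply_sub_mem` — GLOBAL form, any stable subgroup `F` (in place of
  `Fil_w W_{m,j}`): `σ₀ ∈ Γ_K`, `κ(σ₀) = p^s`, `2p^s < m`, `F ≤ W_{m,j}` stable under `A_{m,j}` and `σ₀`, `x` with
  `σ₀ x − x ∈ [T]^i·W + F` ⇒ **`[T]^{2p^s} • x ∈ [T]^i·W + F`** and `(p : ℤ) • x ∈ [T]^i·W + F`;
* `ZpExtension.OrdinaryFiltration.mk_X_pow_two_mul_smul_mem_sup_twistedFil_of_forall_toLocal_sub_mem` — LOCAL form at a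
  finite place `w` with `g₀ ∈ Γ_{K_w}`, `κ(g₀) = p^s`, `2p^s < m`, `F := Fil_w W_{m,j}` of an ordinary datum `Φ`
  (`OrdinaryFiltration.twistedFil`): every `x` invariant modulo `[T]^i·W_{m,j} + Fil_w W_{m,j}` has
  `[T]^{2p^s} • x`, `(p : ℤ) • x ∈ [T]^i·W_{m,j} + Fil_w W_{m,j}` — i.e. **`[T]^{2p^s} · H⁰(K_w, gr_w(T/π^iT)) = 0` for
  every `i` and every host level `j`**, exponent uniform in `i`, `j`, `m`;
* `…exists_forall_mk_X_pow_smul_mem_sup_twistedFil_of_not_decomp_le` — packaged: `decomp w ⊄ ker κ ⇒ ∃ r m₀, ∀ m > m₀,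
  ∀ j i Φ x, …` (`r = 2p^{s_w}`, `m₀ = 2p^{s_w}`), the (hTor)-input shape of the torsion-cut readout
  (`Tower.map_levelCondition_eq_map_torsionCut`, hypothesis «`[T]^r` kills `H⁰` of every graded level»).

Membership in `[T]^i · W` is spelled `∃ y, [T]^i • y = ·` through the `A_{m,j}`-submodule `Ideal.span {[T]^i} • ⊤`
(`mem_ideal_span_mk_X_pow_smul_top_iff`), the same carrier as the `π`-adic refinement's `PiRefinementDatum.piPow j i`
(`S_𝔮` acting through `A_{m,j}`, `EisensteinLevel.quotient_mk_smul_def`).  No summit statement is proved; BSD is not proved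
by any of this.

References: [Howard2004HeegnerKolyvagin] §1.3 H.4/H.5(b), Def. 1.1.3, §2.2 (proof of Thm. 2.2.10), §3.1, Def. 3.2.5–3.2.6
(arXiv p. 5, 7, 15–16); [GreenbergLNM1716] §2 and proof of Prop. 4.15; [Washington1997] §13.2.
-/

set_option autoImplicit false

noncomputable section

open Polynomial Field
open scoped ContRepresentation Pointwise

universe u v

namespace Literature.NumberTheory.EllipticCurves

/-! ## §1 The submodule `[T]^i · V` -/

namespace IwasawaAlgebra.EisensteinCoeff

variable {p : ℕ} [hp : Fact p.Prime] {m k : ℕ} {V : Type v} [AddCommGroup V] [Module (EisensteinCoeff p m k) V]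

/-- Membership in `[T]^i · V = Ideal.span {[T]^i} • ⊤`: `x = [T]^i • y` for some `y`.
[cite: Howard2004HeegnerKolyvagin, Def. 1.1.3 (arXiv p. 5 L93–99: the quotients T/IT, I = (π^i))] -/
theorem mem_ideal_span_mk_X_pow_smul_top_iff (i : ℕ) (x : V) :
    x ∈ (Ideal.span {(Ideal.Quotient.mk _ PowerSeries.X : EisensteinCoeff p m k) ^ i} • (⊤ : Submodule (EisensteinCoeff p m k) V)) ↔
      ∃ y : V, (Ideal.Quotient.mk _ PowerSeries.X : EisensteinCoeff p m k) ^ i • y = x := by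
  rw [Submodule.ideal_span_singleton_smul, Submodule.mem_smul_pointwise_iff_exists]
  simp

/-- `[T]^i · V` is stable under every additive map commuting with the scalars of `A_{m,k}` (e.g. the Galois action).
[cite: Howard2004HeegnerKolyvagin, Def. 1.1.3 (arXiv p. 5 L93–99)] -/
theorem map_mem_ideal_span_mk_X_pow_smul_top (i : ℕ) (f : V →+ V)
    (hf : ∀ (c : EisensteinCoeff p m k) (y : V), f (c • y) = c • f y) {x : V}
    (hx : x ∈ (Ideal.span {(Ideal.Quotient.mk _ PowerSeries.X : EisensteinCoeff p m k) ^ i} • (⊤ : Submodule (EisensteinCoeff p m k) V))) :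
    f x ∈ (Ideal.span {(Ideal.Quotient.mk _ PowerSeries.X : EisensteinCoeff p m k) ^ i} • (⊤ : Submodule (EisensteinCoeff p m k) V)) := by
  obtain ⟨y, rfl⟩ := (mem_ideal_span_mk_X_pow_smul_top_iff i x).mp hx
  exact (mem_ideal_span_mk_X_pow_smul_top_iff i _).mpr ⟨f y, (hf _ y).symm⟩

/-- The subgroup `[T]^i · V + F` is stable under the scalars of `A_{m,k}` when `F` is.
[cite: Howard2004HeegnerKolyvagin, §3.1 (arXiv p. 15: Fil_v T ⊗ S_𝔮 is an S_𝔮-submodule)] -/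
theorem smul_mem_sup_of_smul_mem (i : ℕ) {F : AddSubgroup V}
    (hF : ∀ (c : EisensteinCoeff p m k) (y : V), y ∈ F → c • y ∈ F) (c : EisensteinCoeff p m k) {x : V}
    (hx : x ∈ (Ideal.span {(Ideal.Quotient.mk _ PowerSeries.X : EisensteinCoeff p m k) ^ i} •
      (⊤ : Submodule (EisensteinCoeff p m k) V)).toAddSubgroup ⊔ F) :
    c • x ∈ (Ideal.span {(Ideal.Quotient.mk _ PowerSeries.X : EisensteinCoeff p m k) ^ i} •
      (⊤ : Submodule (EisensteinCoeff p m k) V)).toAddSubgroup ⊔ F := by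
  obtain ⟨y, hy, z, hz, rfl⟩ := AddSubgroup.mem_sup.mp hx
  rw [smul_add]
  exact AddSubgroup.mem_sup.mpr ⟨c • y, (Submodule.mem_toAddSubgroup _).mpr (Submodule.smul_mem _ c hy), c • z,
    hF c z hz, rfl⟩

/-- The subgroup `[T]^i · V + F` is stable under an additive map `f` commuting with the scalars when `F` is `f`-stable.
[cite: Howard2004HeegnerKolyvagin, §3.1 (arXiv p. 15: Fil_v T_𝔮 is a G_{K_v}-submodule)] -/
theorem map_mem_sup_of_map_mem (i : ℕ) {F : AddSubgroup V} (f : V →+ V)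
    (hf : ∀ (c : EisensteinCoeff p m k) (y : V), f (c • y) = c • f y) (hF : ∀ y ∈ F, f y ∈ F) {x : V}
    (hx : x ∈ (Ideal.span {(Ideal.Quotient.mk _ PowerSeries.X : EisensteinCoeff p m k) ^ i} •
      (⊤ : Submodule (EisensteinCoeff p m k) V)).toAddSubgroup ⊔ F) :
    f x ∈ (Ideal.span {(Ideal.Quotient.mk _ PowerSeries.X : EisensteinCoeff p m k) ^ i} •
      (⊤ : Submodule (EisensteinCoeff p m k) V)).toAddSubgroup ⊔ F := by
  obtain ⟨y, hy, z, hz, rfl⟩ := AddSubgroup.mem_sup.mp hx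
  rw [map_add]
  exact AddSubgroup.mem_sup.mpr ⟨f y, map_mem_ideal_span_mk_X_pow_smul_top i f hf hy, f z, hF z hz, rfl⟩

end IwasawaAlgebra.EisensteinCoeff

/-! ## §2 Global form: `σ₀` with `κ(σ₀) = p^s` -/

namespace ZpExtension

open IwasawaAlgebra IwasawaAlgebra.EisensteinCoeff Literature.NumberTheory.GaloisRepresentations

variable {K : Type u} [Field K] (W : WeierstrassCurve K) [W.IsElliptic] {p : ℕ} [hp : Fact p.Prime]
  (κ : ZpExtension K p) {m : ℕ} (hm : 1 ≤ m)

/-- **`[T]^{2p^s}` kills the `σ₀`-invariants modulo `[T]^i · W_{m,j} + F`** for any subgroup `F ≤ W_{m,j} = E[p^j] ⊗ A_{m,j}(ψ)`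
stable under `A_{m,j}` and under `σ₀` (`κ(σ₀) = p^s`, `2p^s < m`; `p ≠ 0` in `K`): if `σ₀ x − x ∈ [T]^i·W + F` then
`[T]^{2p^s} • x ∈ [T]^i·W + F` — (B4) `mk_X_pow_two_mul_smul_mem_of_eisensteinTwist_apply_sub_mem` for the stable subgroup
`[T]^i·W + F`.  With `F = Fil_w W_{m,j}` this is `[T]^{2p^s} · H⁰(σ₀, gr_w(T/π^iT)) = 0`.
[cite: Howard2004HeegnerKolyvagin, §1.3 H.4, Def. 1.1.3, §2.2 and §3.1] [cite: GreenbergLNM1716, proof of Prop. 4.15] -/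
theorem mk_X_pow_two_mul_smul_mem_sup_of_apply_sub_mem (hpK : (p : K) ≠ 0)
    {σ₀ : absoluteGaloisGroup K} {s : ℕ} (hσ : (κ σ₀).toAdd = ((p ^ s : ℕ) : ℤ_[p])) (hms : 2 * p ^ s < m) (j i : ℕ)
    (F : AddSubgroup (Twisted p m j (W.geomTorsion ((p : ℤ) ^ j))))
    (hFA : ∀ (c : EisensteinCoeff p m j) (x : Twisted p m j (W.geomTorsion ((p : ℤ) ^ j))), x ∈ F → c • x ∈ F)
    (hFσ : ∀ x ∈ F, κ.eisensteinTwist (W.torsionGaloisModule ((p : ℤ) ^ j)) hm j σ₀ x ∈ F)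
    (x : Twisted p m j (W.geomTorsion ((p : ℤ) ^ j)))
    (hx : κ.eisensteinTwist (W.torsionGaloisModule ((p : ℤ) ^ j)) hm j σ₀ x - x ∈
      (Ideal.span {(Ideal.Quotient.mk _ PowerSeries.X : EisensteinCoeff p m j) ^ i} •
        (⊤ : Submodule (EisensteinCoeff p m j) (Twisted p m j (W.geomTorsion ((p : ℤ) ^ j))))).toAddSubgroup ⊔ F) :
    ((Ideal.Quotient.mk _ PowerSeries.X : EisensteinCoeff p m j) ^ (2 * p ^ s)) • x ∈
      (Ideal.span {(Ideal.Quotient.mk _ PowerSeries.X : EisensteinCoeff p m j) ^ i} •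
        (⊤ : Submodule (EisensteinCoeff p m j) (Twisted p m j (W.geomTorsion ((p : ℤ) ^ j))))).toAddSubgroup ⊔ F :=
  κ.mk_X_pow_two_mul_smul_mem_of_eisensteinTwist_apply_sub_mem W hm hpK hσ hms j _
    (fun c _ hy ↦ smul_mem_sup_of_smul_mem i hFA c hy)
    (fun _ hy ↦ map_mem_sup_of_map_mem i
      (κ.eisensteinTwist (W.torsionGaloisModule ((p : ℤ) ^ j)) hm j σ₀ : _ →+ _)
      (fun c z ↦ κ.eisensteinTwist_apply_smul (W.torsionGaloisModule ((p : ℤ) ^ j)) hm j σ₀ c z) hFσ hy)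
    x hx

/-- **Hence `(p : ℤ) • x ∈ [T]^i · W_{m,j} + F`** (`p = −[T]^m`, `2p^s < m`).
[cite: Howard2004HeegnerKolyvagin, §2.2, proof of Thm. 2.2.10 and §3.1] [cite: GreenbergLNM1716, proof of Prop. 4.15] -/
theorem natCast_smul_mem_sup_of_apply_sub_mem (hpK : (p : K) ≠ 0)
    {σ₀ : absoluteGaloisGroup K} {s : ℕ} (hσ : (κ σ₀).toAdd = ((p ^ s : ℕ) : ℤ_[p])) (hms : 2 * p ^ s < m) (j i : ℕ)
    (F : AddSubgroup (Twisted p m j (W.geomTorsion ((p : ℤ) ^ j))))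
    (hFA : ∀ (c : EisensteinCoeff p m j) (x : Twisted p m j (W.geomTorsion ((p : ℤ) ^ j))), x ∈ F → c • x ∈ F)
    (hFσ : ∀ x ∈ F, κ.eisensteinTwist (W.torsionGaloisModule ((p : ℤ) ^ j)) hm j σ₀ x ∈ F)
    (x : Twisted p m j (W.geomTorsion ((p : ℤ) ^ j)))
    (hx : κ.eisensteinTwist (W.torsionGaloisModule ((p : ℤ) ^ j)) hm j σ₀ x - x ∈
      (Ideal.span {(Ideal.Quotient.mk _ PowerSeries.X : EisensteinCoeff p m j) ^ i} •
        (⊤ : Submodule (EisensteinCoeff p m j) (Twisted p m j (W.geomTorsion ((p : ℤ) ^ j))))).toAddSubgroup ⊔ F) :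
    (p : ℤ) • x ∈
      (Ideal.span {(Ideal.Quotient.mk _ PowerSeries.X : EisensteinCoeff p m j) ^ i} •
        (⊤ : Submodule (EisensteinCoeff p m j) (Twisted p m j (W.geomTorsion ((p : ℤ) ^ j))))).toAddSubgroup ⊔ F :=
  natCast_smul_mem_of_mk_X_pow_smul_mem (fun c _ hy ↦ smul_mem_sup_of_smul_mem i hFA c hy) hms.le
    (κ.mk_X_pow_two_mul_smul_mem_sup_of_apply_sub_mem W hm hpK hσ hms j i F hFA hFσ x hx)

/-! ## §3 Local forms at a finite place `w`, with `F = Fil_w W_{m,j}` -/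

variable {K : Type} [Field K] [NumberField K] (E : WeierstrassCurve K) [E.IsElliptic] (κ' : ZpExtension K p)
  {m : ℕ} (hm : 1 ≤ m)

variable {M : ℕ → Type} [∀ k, AddCommGroup (M k)] [∀ k, TopologicalSpace (M k)] [∀ k, DiscreteTopology (M k)]

/-- **`[T]^{2p^s} · H⁰(K_w, gr_w(T/π^iT)) = 0` in representative form.**  For an ordinary datum `Φ` at `w` on the torsion
tower of `E` (`Fil_w E[p^j]`), `g₀ ∈ Γ_{K_w}` with `κ(g₀) = p^s`, `2p^s < m`: every `x ∈ W_{m,j}` with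
`g x − x ∈ [T]^i · W_{m,j} + Fil_w W_{m,j}` for all `g ∈ Γ_{K_w}` has `[T]^{2p^s} • x ∈ [T]^i · W_{m,j} + Fil_w W_{m,j}` —
for EVERY `i` and `j` (the quotient `W_{m,j}/([T]^i·W_{m,j} + Fil_w W_{m,j})` presents Howard's `gr_w` of the `π`-adic level
`T/π^iT` on its host `j`). [cite: Howard2004HeegnerKolyvagin, Def. 1.1.3, §3.1 (Fil_v, gr_v) and Def. 3.2.6 (arXiv p. 5, 15–16)]
[cite: GreenbergLNM1716, §2 and proof of Prop. 4.15] -/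
theorem OrdinaryFiltration.mk_X_pow_two_mul_smul_mem_sup_twistedFil_of_forall_toLocal_sub_mem
    {w : IsDedekindDomain.HeightOneSpectrum (NumberField.RingOfIntegers K)}
    {t : ∀ k, (E.torsionGaloisModule ((p : ℤ) ^ (k + 1))).toContRepresentation →ⁱL
      (E.torsionGaloisModule ((p : ℤ) ^ k)).toContRepresentation}
    (Φ : OrdinaryFiltration (fun k ↦ E.torsionGaloisModule ((p : ℤ) ^ k)) t w)
    {g₀ : absoluteGaloisGroup (w.adicCompletion K)} {s : ℕ}
    (hg₀ : (κ' (absGaloisRestrict K (w.adicCompletion K) g₀)).toAdd = ((p ^ s : ℕ) : ℤ_[p])) (hms : 2 * p ^ s < m)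
    (j i : ℕ) (x : Twisted p m j (E.geomTorsion ((p : ℤ) ^ j)))
    (hx : ∀ g : absoluteGaloisGroup (w.adicCompletion K),
      ((κ'.eisensteinTwist (E.torsionGaloisModule ((p : ℤ) ^ j)) hm j).toLocal (Sum.inr w)) g x - x ∈
        (Ideal.span {(Ideal.Quotient.mk _ PowerSeries.X : EisensteinCoeff p m j) ^ i} •
          (⊤ : Submodule (EisensteinCoeff p m j) (Twisted p m j (E.geomTorsion ((p : ℤ) ^ j))))).toAddSubgroup ⊔
          (Φ.twistedFil (p := p) (m := m) j).toAddSubgroup) :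
    ((Ideal.Quotient.mk _ PowerSeries.X : EisensteinCoeff p m j) ^ (2 * p ^ s)) • x ∈
      (Ideal.span {(Ideal.Quotient.mk _ PowerSeries.X : EisensteinCoeff p m j) ^ i} •
        (⊤ : Submodule (EisensteinCoeff p m j) (Twisted p m j (E.geomTorsion ((p : ℤ) ^ j))))).toAddSubgroup ⊔
        (Φ.twistedFil (p := p) (m := m) j).toAddSubgroup :=
  κ'.mk_X_pow_two_mul_smul_mem_sup_of_apply_sub_mem E hm (Nat.cast_ne_zero.2 hp.out.ne_zero) hg₀ hms j i
    (Φ.twistedFil (p := p) (m := m) j).toAddSubgroup (fun c _ hy ↦ Φ.smul_mem_twistedFil j c hy)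
    (fun _ hy ↦ Φ.twistedFil_le_comap (κ := κ') hm j g₀ hy) x (hx g₀)

/-- And `(p : ℤ) • x ∈ [T]^i · W_{m,j} + Fil_w W_{m,j}` (`p · H⁰(K_w, gr_w(T/π^iT)) = 0`).
[cite: Howard2004HeegnerKolyvagin, Def. 1.1.3, §3.1 and Def. 3.2.6] [cite: GreenbergLNM1716, §2 and proof of Prop. 4.15] -/
theorem OrdinaryFiltration.natCast_smul_mem_sup_twistedFil_of_forall_toLocal_sub_mem
    {w : IsDedekindDomain.HeightOneSpectrum (NumberField.RingOfIntegers K)}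
    {t : ∀ k, (E.torsionGaloisModule ((p : ℤ) ^ (k + 1))).toContRepresentation →ⁱL
      (E.torsionGaloisModule ((p : ℤ) ^ k)).toContRepresentation}
    (Φ : OrdinaryFiltration (fun k ↦ E.torsionGaloisModule ((p : ℤ) ^ k)) t w)
    {g₀ : absoluteGaloisGroup (w.adicCompletion K)} {s : ℕ}
    (hg₀ : (κ' (absGaloisRestrict K (w.adicCompletion K) g₀)).toAdd = ((p ^ s : ℕ) : ℤ_[p])) (hms : 2 * p ^ s < m)
    (j i : ℕ) (x : Twisted p m j (E.geomTorsion ((p : ℤ) ^ j)))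
    (hx : ∀ g : absoluteGaloisGroup (w.adicCompletion K),
      ((κ'.eisensteinTwist (E.torsionGaloisModule ((p : ℤ) ^ j)) hm j).toLocal (Sum.inr w)) g x - x ∈
        (Ideal.span {(Ideal.Quotient.mk _ PowerSeries.X : EisensteinCoeff p m j) ^ i} •
          (⊤ : Submodule (EisensteinCoeff p m j) (Twisted p m j (E.geomTorsion ((p : ℤ) ^ j))))).toAddSubgroup ⊔
          (Φ.twistedFil (p := p) (m := m) j).toAddSubgroup) :
    (p : ℤ) • x ∈
      (Ideal.span {(Ideal.Quotient.mk _ PowerSeries.X : EisensteinCoeff p m j) ^ i} •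
        (⊤ : Submodule (EisensteinCoeff p m j) (Twisted p m j (E.geomTorsion ((p : ℤ) ^ j))))).toAddSubgroup ⊔
        (Φ.twistedFil (p := p) (m := m) j).toAddSubgroup :=
  κ'.natCast_smul_mem_sup_of_apply_sub_mem E hm (Nat.cast_ne_zero.2 hp.out.ne_zero) hg₀ hms j i
    (Φ.twistedFil (p := p) (m := m) j).toAddSubgroup (fun c _ hy ↦ Φ.smul_mem_twistedFil j c hy)
    (fun _ hy ↦ Φ.twistedFil_le_comap (κ := κ') hm j g₀ hy) x (hx g₀)

/-- **(F4a) packaged: uniform annihilation of the local invariants of ALL graded `π`-adic levels.**  If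
`decomp w ⊄ ker κ` then there are `r` (`= 2p^{s_w}`) and `m₀` (`= 2p^{s_w}`) such that for every `m > m₀`, every host
level `j`, every `π`-adic exponent `i`, every ordinary datum `Φ` at `w` and every `x ∈ W_{m,j}` invariant modulo
`[T]^i · W_{m,j} + Fil_w W_{m,j}`:  `[T]^r • x` and `(p : ℤ) • x` lie in `[T]^i · W_{m,j} + Fil_w W_{m,j}` — the
(hTor)-input «`[T]^r · H⁰(K_w, gr_w(T/π^iT)) = 0`, uniformly in `i`» of the torsion-cut readout of `F_𝔮` at `w ∣ p`.
[cite: Howard2004HeegnerKolyvagin, §1.3 H.5(b), Def. 1.1.3, §3.1 and Def. 3.2.6] [cite: GreenbergLNM1716, §2 and proof of Prop. 4.15] -/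
theorem OrdinaryFiltration.exists_forall_mk_X_pow_smul_mem_sup_twistedFil_of_not_decomp_le
    (w : IsDedekindDomain.HeightOneSpectrum (NumberField.RingOfIntegers K))
    (hdec : ¬ (GreenbergSelmer.decomp w ≤ κ'.kerSubgroup))
    (t : ∀ k, (E.torsionGaloisModule ((p : ℤ) ^ (k + 1))).toContRepresentation →ⁱL
      (E.torsionGaloisModule ((p : ℤ) ^ k)).toContRepresentation) :
    ∃ r m₀ : ℕ, ∀ (m : ℕ) (hm : 1 ≤ m), m₀ < m → ∀ (j i : ℕ)
      (Φ : OrdinaryFiltration (fun k ↦ E.torsionGaloisModule ((p : ℤ) ^ k)) t w)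
      (x : Twisted p m j (E.geomTorsion ((p : ℤ) ^ j))),
      (∀ g : absoluteGaloisGroup (w.adicCompletion K),
        ((κ'.eisensteinTwist (E.torsionGaloisModule ((p : ℤ) ^ j)) hm j).toLocal (Sum.inr w)) g x - x ∈
          (Ideal.span {(Ideal.Quotient.mk _ PowerSeries.X : EisensteinCoeff p m j) ^ i} •
            (⊤ : Submodule (EisensteinCoeff p m j) (Twisted p m j (E.geomTorsion ((p : ℤ) ^ j))))).toAddSubgroup ⊔
            (Φ.twistedFil (p := p) (m := m) j).toAddSubgroup) →
      ((Ideal.Quotient.mk _ PowerSeries.X : EisensteinCoeff p m j) ^ r) • x ∈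
          (Ideal.span {(Ideal.Quotient.mk _ PowerSeries.X : EisensteinCoeff p m j) ^ i} •
            (⊤ : Submodule (EisensteinCoeff p m j) (Twisted p m j (E.geomTorsion ((p : ℤ) ^ j))))).toAddSubgroup ⊔
            (Φ.twistedFil (p := p) (m := m) j).toAddSubgroup ∧
        (p : ℤ) • x ∈
          (Ideal.span {(Ideal.Quotient.mk _ PowerSeries.X : EisensteinCoeff p m j) ^ i} •
            (⊤ : Submodule (EisensteinCoeff p m j) (Twisted p m j (E.geomTorsion ((p : ℤ) ^ j))))).toAddSubgroup ⊔
            (Φ.twistedFil (p := p) (m := m) j).toAddSubgroup := by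
  obtain ⟨s, g₀, hg₀⟩ := κ'.exists_toAdd_apply_absGaloisRestrict_eq_pow_of_not_decomp_le w hdec
  refine ⟨2 * p ^ s, 2 * p ^ s, fun m hm hm₀ j i Φ x hx ↦ ⟨?_, ?_⟩⟩
  · exact Φ.mk_X_pow_two_mul_smul_mem_sup_twistedFil_of_forall_toLocal_sub_mem E κ' hm hg₀ hm₀ j i x hx
  · exact Φ.natCast_smul_mem_sup_twistedFil_of_forall_toLocal_sub_mem E κ' hm hg₀ hm₀ j i x hx

end ZpExtension

/-! ## §4 Dictionary with the `π`-adic refinement's currency (`PiRefinementDatum.piPow`, scalar `π ∈ S_𝔮`) -/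

namespace ZpExtension

open IwasawaAlgebra IwasawaAlgebra.EisensteinCoeff Literature.NumberTheory.GaloisRepresentations
open Literature.NumberTheory.GaloisCohomology.Howard2004

variable {K : Type} [Field K] [NumberField K] (E : WeierstrassCurve K) [E.IsElliptic] {p : ℕ} [hp : Fact p.Prime]
  (κ' : ZpExtension K p) {m : ℕ} (hm : 1 ≤ m)

/-- **The scalar `π^r` of the curve's `π`-adic refinement datum acts on the level `T^{(k)} = E[p^k] ⊗ A_{m,k}(ψ)` as
`[T]^r ∈ A_{m,k}`** (`π = T mod 𝔮`, `S_𝔮` acting through `S_𝔮 ↠ A_{m,k}`, `EisensteinLevel.quotient_mk_smul_def`).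
[cite: Howard2004HeegnerKolyvagin, §1.6 and §2.2 (arXiv p. 12: the S_𝔮-module T_𝔮 and its levels)] -/
theorem eisensteinPiRefinementDatum_pi_pow_smul (r k : ℕ) (x : EisensteinLevel p m (fun j ↦ E.geomTorsion ((p : ℤ) ^ j)) k) :
    (E.eisensteinPiRefinementDatum κ' hm).π ^ r • x =
      ((Ideal.Quotient.mk _ PowerSeries.X : EisensteinCoeff p m k) ^ r) • x := by
  rw [E.eisensteinPiRefinementDatum_π κ' hm, ← map_pow, EisensteinLevel.quotient_mk_smul_def]
  exact congrArg (· • x) (map_pow _ _ _)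

/-- **`π^i · T^{(k)}` IS `[T]^i · W_{m,k}`**: membership in `(E.eisensteinPiRefinementDatum κ hm).piPow k i` (the
`S_𝔮`-submodule `Ideal.span {π^i} • ⊤` of the level synonym) is `x = [T]^i • y` with the `A_{m,k}`-scalar `[T]^i` — the
membership of `mem_ideal_span_mk_X_pow_smul_top_iff` (with `V := EisensteinLevel … k` or the underlying `Twisted`), so that
§3 reads on the presentations `Level i = T^{(host i)} ⧸ π^i·T^{(host i)}` and `gr_w(Level i)` of the uniform-`ι` road.
[cite: Howard2004HeegnerKolyvagin, Def. 1.1.3 and §1.6 (arXiv p. 5 L93–99, p. 12 L29–55)] -/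
theorem mem_piPow_eisensteinPiRefinementDatum_iff (k i : ℕ)
    (x : EisensteinLevel p m (fun j ↦ E.geomTorsion ((p : ℤ) ^ j)) k) :
    x ∈ (E.eisensteinPiRefinementDatum κ' hm).piPow k i ↔
      ∃ y : EisensteinLevel p m (fun j ↦ E.geomTorsion ((p : ℤ) ^ j)) k,
        ((Ideal.Quotient.mk _ PowerSeries.X : EisensteinCoeff p m k) ^ i) • y = x := by
  rw [PiRefinementDatum.mem_piPow_iff]
  constructor
  · rintro ⟨y, hy⟩
    exact ⟨y, by rw [← eisensteinPiRefinementDatum_pi_pow_smul E κ' hm i k y]; exact hy⟩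
  · rintro ⟨y, hy⟩
    exact ⟨y, by rw [eisensteinPiRefinementDatum_pi_pow_smul E κ' hm i k y]; exact hy⟩

/-! ## §5 The (F4a) target shape: invariants of the `π`-adic level `Level i` modulo its plus part `piFil i` -/

/-- **(F4a) in the `π`-adic level currency.**  For the curve's refinement datum `D`, an ordinary datum `Φ` at `w` on the torsion
tower, `g₀ ∈ Γ_{K_w}` with `κ(g₀) = p^s`, `2p^s < m`, and every `π`-adic exponent `i`: an element `x` of the level
`D.Level i = T^{(host i)} ⧸ π^i·T^{(host i)}` that is `Γ_{K_w}`-invariant MODULO the plus part `piFil i` (image of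
`Fil_w W_{m,host i}`) satisfies **`π^{2p^s} • x ∈ piFil i`** — `π^{2p^s}` kills `H⁰(K_w, Level i ⧸ piFil i) = H⁰(K_w, gr_w(T/π^iT))`,
uniformly in `i` and `m` (lift to the host level by `Submodule.Quotient`, apply §3 with `[T]^i·W + Fil_w W`, push down by
`mem_piFil_iff`). [cite: Howard2004HeegnerKolyvagin, Def. 1.1.3, §3.1 (Fil_v, gr_v) and Def. 3.2.6 (arXiv p. 5, 15–16)]
[cite: GreenbergLNM1716, §2 and proof of Prop. 4.15] -/
theorem OrdinaryFiltration.pi_pow_smul_mem_piFil_of_forall_toLocal_levelRep_sub_mem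
    {w : IsDedekindDomain.HeightOneSpectrum (NumberField.RingOfIntegers K)}
    (Φ : OrdinaryFiltration (fun j ↦ E.torsionGaloisModule ((p : ℤ) ^ j)) (fun j ↦ E.torsionGaloisModuleReduce p j) w)
    {g₀ : absoluteGaloisGroup (w.adicCompletion K)} {s : ℕ}
    (hg₀ : (κ' (absGaloisRestrict K (w.adicCompletion K) g₀)).toAdd = ((p ^ s : ℕ) : ℤ_[p])) (hms : 2 * p ^ s < m)
    (i : ℕ) (x : (E.eisensteinPiRefinementDatum κ' hm).Level i)
    (hx : ∀ σ : absoluteGaloisGroup (w.adicCompletion K),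
      GaloisRep.toLocal w ((E.eisensteinPiRefinementDatum κ' hm).levelRep i) σ x - x ∈ E.piFil κ' hm Φ i) :
    (E.eisensteinPiRefinementDatum κ' hm).π ^ (2 * p ^ s) • x ∈ E.piFil κ' hm Φ i := by
  obtain ⟨y, rfl⟩ := Submodule.Quotient.mk_surjective _ x
  -- everything below is typed on the host level synonym `EisensteinLevel … (host i)`
  let F : Submodule ℤ (EisensteinLevel p m (fun j ↦ E.geomTorsion ((p : ℤ) ^ j)) ((E.eisensteinPiRefinementDatum κ' hm).host i)) :=
    Φ.twistedFil (p := p) (m := m) ((E.eisensteinPiRefinementDatum κ' hm).host i)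
  let P : Submodule (EisensteinCoeff p m ((E.eisensteinPiRefinementDatum κ' hm).host i))
      (EisensteinLevel p m (fun j ↦ E.geomTorsion ((p : ℤ) ^ j)) ((E.eisensteinPiRefinementDatum κ' hm).host i)) :=
    Ideal.span {(Ideal.Quotient.mk _ PowerSeries.X :
        EisensteinCoeff p m ((E.eisensteinPiRefinementDatum κ' hm).host i)) ^ i} • ⊤
  have hF : ∀ z, z ∈ F ↔ (z : Twisted p m ((E.eisensteinPiRefinementDatum κ' hm).host i)
      (E.geomTorsion ((p : ℤ) ^ ((E.eisensteinPiRefinementDatum κ' hm).host i)))) ∈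
        Φ.twistedFil (p := p) (m := m) ((E.eisensteinPiRefinementDatum κ' hm).host i) := fun _ ↦ Iff.rfl
  -- the hypothesis at the host level: `ρ(σ) y − y ∈ [T]^i · T^{(host i)} + Fil`
  have hy : ∀ g : absoluteGaloisGroup (w.adicCompletion K),
      (E.eisensteinPiRefinementDatum κ' hm).ρ ((E.eisensteinPiRefinementDatum κ' hm).host i)
          (absGaloisRestrict K (w.adicCompletion K) g) y - y ∈ P.toAddSubgroup ⊔ F.toAddSubgroup := by
    intro g
    have h := hx g
    rw [GaloisRep.toLocal_apply, PiRefinementDatum.levelRep_apply_mk, ← Submodule.Quotient.mk_sub,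
      WeierstrassCurve.mem_piFil_iff] at h
    obtain ⟨z, hz, hzq⟩ := h
    obtain ⟨u, hu⟩ := (mem_piPow_eisensteinPiRefinementDatum_iff E κ' hm _ i _).mp ((Submodule.Quotient.eq _).mp hzq)
    refine AddSubgroup.mem_sup.mpr
      ⟨((Ideal.Quotient.mk _ PowerSeries.X : EisensteinCoeff p m ((E.eisensteinPiRefinementDatum κ' hm).host i)) ^ i) • (-u),
        (Submodule.mem_toAddSubgroup _).mpr ((mem_ideal_span_mk_X_pow_smul_top_iff i _).mpr ⟨-u, rfl⟩), z,
        (Submodule.mem_toAddSubgroup _).mpr ((hF z).mpr hz), ?_⟩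
    rw [smul_neg, hu]
    abel
  -- §3 at the host level (the statement there is on the underlying `Twisted`, definitionally the same)
  have h : ((Ideal.Quotient.mk _ PowerSeries.X : EisensteinCoeff p m ((E.eisensteinPiRefinementDatum κ' hm).host i)) ^
        (2 * p ^ s)) • y ∈ P.toAddSubgroup ⊔ F.toAddSubgroup :=
    Φ.mk_X_pow_two_mul_smul_mem_sup_twistedFil_of_forall_toLocal_sub_mem E κ' hm hg₀ hms
      ((E.eisensteinPiRefinementDatum κ' hm).host i) i y hy
  obtain ⟨a, ha, b, hb, hab⟩ := AddSubgroup.mem_sup.mp h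
  obtain ⟨u', hu'⟩ := (mem_ideal_span_mk_X_pow_smul_top_iff i a).mp ((Submodule.mem_toAddSubgroup _).mp ha)
  rw [← Submodule.Quotient.mk_smul, WeierstrassCurve.mem_piFil_iff]
  refine ⟨b, (hF b).mp ((Submodule.mem_toAddSubgroup _).mp hb), ?_⟩
  rw [Submodule.Quotient.eq, mem_piPow_eisensteinPiRefinementDatum_iff]
  refine ⟨-u', ?_⟩
  rw [smul_neg, hu', eisensteinPiRefinementDatum_pi_pow_smul E κ' hm, ← hab]
  abel

end ZpExtension

end Literature.NumberTheory.EllipticCurves
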